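import Summits.ValiantsHypothesis.ValiantsHypothesis.Theorems.DepthWindowTopBracketExpansion
import Summits.ValiantsHypothesis.ValiantsHypothesis.Theorems.DepthWindowTopBracketLevels
import HarnessLib

/-!
# Route `DepthWindow` — top bracket of the product-depth dial, part 4/5: the circuit and the depth reduction

Decomp-valiant workshop, lens 4, generation 48 (cell O32).  Route-independent, definition-free.  Product depth
(`≤ Λ`: one layer of product gates per level), wires, and correctness of the levelled circuit of part 1 (invariant: part 3);
then the `K`-fold scheme of parts 1–2 with `Λ = ⌈⌈log₂ d⌉/K⌉` levels (`d ≤ 2^⌈log₂ d⌉ ≤ (2^K)^Λ`):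

* `exists_computes_productDepth_le_clog_div (hK : 1 ≤ K) (hd : f.totalDegree ≤ d) :
    ∃ C, C.Computes f ∧ C.productDepth ≤ (Nat.clog 2 d + K - 1) / K ∧
      C.edgeSize ≤ iterEdgeBound K (card σ) d (complexity f)`,
  `iterEdgeBound K N d L` polynomial in `N, d, L` for FIXED `K` (exponent `O(5^K)`; part 5 proves
  `IsPBounded`).  `K = 1` is the tree's `DepthReduction.exists_computes_productDepth_le_clog` (VSBR).

WHY POLYNOMIAL (the point of cell O32): the atoms are SHARED across levels, so the size is
`#levels × #atoms × (#ι²)^(O(5^K))`; the factor `Δ` in the exponent of the FORMULA bound `n^(O(Δ·d^(1/Δ)))`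
(Limaye–Srinivasan–Tavenas, §1, IMM formulas of product-depth `Δ`) is a no-sharing artefact.  VSBR 1983 /
Bürgisser 2000 Thm. 2.5 state `O(log d)` multiplication levels; that the constant can be ANY `1/K` at
polynomial size is the folklore regrouping kernel-checked here — no novelty beyond bookkeeping is claimed.
Nothing here bears on `VP ≠ VNP`; 0 sorry, standard axioms.

References: [ValiantSkyumBerkowitzRackoff1983]; [Burgisser2000TCS] Thm. 2.5; [Tavenas2015] §4 Def. 4, §5 Prop. 3;
[AgrawalVinay2008]; [LimayeSrinivasanTavenas2025] §1 (product depth).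
-/

-- layout Summits/ValiantsHypothesis/ValiantsHypothesis forces the duplicated namespace component
set_option linter.dupNamespace false

noncomputable section

open MvPolynomial Literature.Computability.AlgebraicComplexity
open Literature.Computability.AlgebraicComplexity.DepthReduction ArithCircuit
open Literature.Computability.AlgebraicComplexity.DepthReduction.HomCircuit (Atom termWidth)

namespace Summit.ValiantsHypothesis.ValiantsHypothesis.Theorems.DepthWindow

namespace TopBracket

universe u v w

variable {k : Type u} {σ : Type v} {ι : Type w} [CommSemiring k]

namespace Scheme

variable {H : HomCircuit k σ ι} [DecidableEq ι] [Fintype ι] (S : Scheme H) [Fintype σ] [DecidableEq σ]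

/-! ### Product depth of the levels -/

/-- All gates of the levels `0, …, j` have product-depth `≤ j` (one layer of product gates per
level). [cite: ValiantSkyumBerkowitzRackoff1983] [cite: LimayeSrinivasanTavenas2025, §1] -/
theorem depths_gatesUpTo_le : ∀ j : ℕ,
    ∀ x ∈ gateWDepths (fun g : Gate k σ => if g.isProd then 1 else 0) (S.gatesUpTo j), x ≤ j
  | 0 => by
    intro x hx
    have h0 := gateWDepths_layer (fun g : Gate k σ => if g.isProd then 1 else 0) [] (levelZero H)
      (refs_levelZero H)
    simp only [List.nil_append] at h0
    rw [gatesUpTo, h0] at hx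
    simp only [gateWDepths, List.foldl_nil, List.nil_append, List.mem_map] at hx
    obtain ⟨g, hg, rfl⟩ := hx
    simp only [levelZero, List.mem_map] at hg
    obtain ⟨m, -, rfl⟩ := hg
    rw [foldr_depthIn_affineGate]
    simp [isProd_affineGate]
  | j + 1 => by
    have ih := depths_gatesUpTo_le j
    generalize hw : (fun g : Gate k σ => if g.isProd then 1 else 0) = w at ih ⊢
    have hw_prod : ∀ args, w (.prod args) = 1 := fun _ => by rw [← hw]; rfl
    have hw_sum : ∀ args, w (.sum args) = 0 := fun _ => by rw [← hw]; rfl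
    have hB : ∀ x ∈ gateWDepths w (S.gatesUpTo j ++ S.prodLayer j), x ≤ j + 1 := by
      rw [gateWDepths_layer w _ _ (S.refs_prodLayer j)]
      intro x hx
      rcases List.mem_append.1 hx with hx | hx
      · exact (ih x hx).trans (Nat.le_succ j)
      · obtain ⟨g, hg, rfl⟩ := List.mem_map.1 hx
        simp only [prodLayer, List.mem_map] at hg
        obtain ⟨q, -, rfl⟩ := hg
        unfold prodGate
        split_ifs with h
        · rw [hw_prod, Nat.add_comm]
          exact Nat.succ_le_succ (foldr_max_le fun x hx => by
            obtain ⟨u, -, rfl⟩ := List.mem_map.1 hx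
            exact depthIn_le ih u)
        · rw [hw_sum]
          simp [Gate.args]
    rw [gatesUpTo, gateWDepths_layer w _ _ (S.refs_sumLayer j)]
    intro x hx
    rcases List.mem_append.1 hx with hx | hx
    · exact hB x hx
    · obtain ⟨g, hg, rfl⟩ := List.mem_map.1 hx
      simp only [sumLayer, List.mem_map] at hg
      obtain ⟨m, -, rfl⟩ := hg
      have hfold : ∀ args : List (k × Operand k σ), w (.sum args) +
          ((Gate.args (Gate.sum args)).map (Operand.depthIn
            (gateWDepths w (S.gatesUpTo j ++ S.prodLayer j)))).foldr max 0 ≤ j + 1 := by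
        intro args
        rw [hw_sum, zero_add]
        exact foldr_max_le fun x hx => by
          obtain ⟨u, -, rfl⟩ := List.mem_map.1 hx
          exact depthIn_le hB u
      unfold sumGate
      split_ifs <;> exact hfold _

/-! ### Wires of the levels -/

/-- The levels `0, …, j` have at most `#atoms·(#σ+1) + j·(#atoms·W·F + #atoms·(W+1))` wires.
[cite: ValiantSkyumBerkowitzRackoff1983] -/
theorem fanIn_sum_gatesUpTo_le : ∀ j : ℕ, ((S.gatesUpTo j).map Gate.fanIn).sum ≤
    Fintype.card (Atom ι) * (Fintype.card σ + 1) +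
      j * (Fintype.card (Atom ι) * S.W * S.F + Fintype.card (Atom ι) * (S.W + 1))
  | 0 => by
    simp only [gatesUpTo, levelZero, List.map_map, Function.comp_def, fanIn_affineGate,
      List.map_const', List.sum_replicate, List.length_finRange, smul_eq_mul, zero_mul, add_zero,
      le_refl]
  | j + 1 => by
    have ih := fanIn_sum_gatesUpTo_le j
    rw [gatesUpTo, List.map_append, List.map_append, List.sum_append, List.sum_append]
    have hP : ((S.prodLayer j).map Gate.fanIn).sum ≤ Fintype.card (Atom ι) * S.W * S.F := by
      have h5 := List.sum_le_card_nsmul ((S.prodLayer j).map Gate.fanIn) S.F fun x hx => by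
        obtain ⟨g, hg, rfl⟩ := List.mem_map.1 hx
        simp only [prodLayer, List.mem_map] at hg
        obtain ⟨q, -, rfl⟩ := hg
        exact S.fanIn_prodGate_le _ _ _
      rwa [List.length_map, length_prodLayer, smul_eq_mul] at h5
    have hS : ((S.sumLayer j).map Gate.fanIn).sum ≤ Fintype.card (Atom ι) * (S.W + 1) := by
      have h5 := List.sum_le_card_nsmul ((S.sumLayer j).map Gate.fanIn) (S.W + 1)
        fun x hx => by
          obtain ⟨g, hg, rfl⟩ := List.mem_map.1 hx
          simp only [sumLayer, List.mem_map] at hg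
          obtain ⟨m, -, rfl⟩ := hg
          exact S.fanIn_sumGate_le _ _
      rwa [List.length_map, length_sumLayer, smul_eq_mul] at h5
    calc _ ≤ Fintype.card (Atom ι) * (Fintype.card σ + 1) +
          j * (Fintype.card (Atom ι) * S.W * S.F + Fintype.card (Atom ι) * (S.W + 1)) +
          Fintype.card (Atom ι) * S.W * S.F + Fintype.card (Atom ι) * (S.W + 1) :=
        add_le_add (add_le_add ih hP) hS
      _ = _ := by ring

/-! ### The circuit -/

/-- The output gate refers only to the levels. [folklore] -/
theorem refs_top (Λ : ℕ) (ns : List (Atom ι)) :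
    ∀ g ∈ [(Gate.sum (ns.map fun a => ((1 : k), Operand.gate (S.vIdx Λ a))) : Gate k σ)],
      ∀ u ∈ g.args, u.RefsBelow (S.gatesUpTo Λ).length := by
  intro g hg u hu
  simp only [List.mem_singleton] at hg
  subst hg
  simp only [Gate.args, List.map_map, List.mem_map, Function.comp] at hu
  obtain ⟨a, -, rfl⟩ := hu
  simp only [Operand.RefsBelow, length_gatesUpTo]
  exact S.vIdx_lt_plen Λ a

/-- **Correctness**: if every atom of `ns` has formal degree `≤ B^Λ`, the circuit computes the sum of
their values. [cite: ValiantSkyumBerkowitzRackoff1983] [cite: Burgisser2000TCS, Thm. 2.5] -/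
theorem eval_circuit (Λ : ℕ) (ns : List (Atom ι)) (hns : ∀ a ∈ ns, H.adeg a ≤ S.B ^ Λ) :
    (S.circuit Λ ns).eval = (ns.map H.aval).sum := by
  have hlen : (gateValues (S.gatesUpTo Λ)).length = S.plen Λ := by
    rw [gateValues_length, length_gatesUpTo]
  simp only [circuit, ArithCircuit.eval]
  rw [gateValues_layer _ _ (S.refs_top Λ ns)]
  simp only [List.map_singleton, Operand.eval_gate, List.getD_eq_getElem?_getD]
  rw [List.getElem?_append_right (le_of_eq hlen), hlen, Nat.sub_self, List.getElem?_cons_zero,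
    Option.getD_some]
  simp only [Gate.eval, List.map_map]
  congr 1
  apply List.map_congr_left
  intro a ha
  simp only [Function.comp, Operand.eval_gate, one_smul, List.getD_eq_getElem?_getD]
  rw [S.gateValues_gatesUpTo Λ a (hns a ha), Option.getD_some]

/-- **Product depth** `≤ Λ`. [cite: ValiantSkyumBerkowitzRackoff1983] [cite: LimayeSrinivasanTavenas2025, §1] -/
theorem productDepth_circuit_le (Λ : ℕ) (ns : List (Atom ι)) :
    (S.circuit Λ ns).productDepth ≤ Λ := by
  unfold ArithCircuit.productDepth ArithCircuit.wdepth
  have hD := S.depths_gatesUpTo_le Λ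
  generalize hw : (fun g : Gate k σ => if g.isProd then 1 else 0) = w at hD ⊢
  have hw_sum : ∀ args, w (.sum args) = 0 := fun _ => by rw [← hw]; rfl
  have hall : ∀ x ∈ gateWDepths w (S.circuit Λ ns).gates, x ≤ Λ := by
    simp only [circuit]
    rw [gateWDepths_layer w _ _ (S.refs_top Λ ns)]
    intro x hx
    rcases List.mem_append.1 hx with hx | hx
    · exact hD x hx
    · simp only [List.map_singleton, List.mem_singleton] at hx
      subst hx
      rw [hw_sum, zero_add]
      exact foldr_max_le fun x hx => by
        obtain ⟨u, -, rfl⟩ := List.mem_map.1 hx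
        exact depthIn_le hD u
  exact depthIn_le hall _

/-- **Wires**. [cite: ValiantSkyumBerkowitzRackoff1983] -/
theorem edgeSize_circuit_le (Λ : ℕ) (ns : List (Atom ι)) :
    (S.circuit Λ ns).edgeSize ≤ Fintype.card (Atom ι) * (Fintype.card σ + 1) +
      Λ * (Fintype.card (Atom ι) * S.W * S.F + Fintype.card (Atom ι) * (S.W + 1)) + ns.length := by
  unfold ArithCircuit.edgeSize
  simp only [circuit, List.map_append, List.sum_append, List.map_singleton, List.sum_singleton]
  have hfan : ((Gate.sum (ns.map fun a => ((1 : k), Operand.gate (S.vIdx Λ a)))) :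
      Gate k σ).fanIn = ns.length := by
    simp [Gate.fanIn, Gate.args]
  rw [hfan]
  exact Nat.add_le_add_right (S.fanIn_sum_gatesUpTo_le Λ) _

end Scheme

/-! ## §3 The depth reduction to `⌈⌈log₂ d⌉ / K⌉` product levels -/

section Reduction

/-- `⌈c / K⌉ ≤ c` for `K ≥ 1`. [folklore] -/
theorem cdiv_le {K : ℕ} (hK : 1 ≤ K) (c : ℕ) : (c + K - 1) / K ≤ c := by
  rcases Nat.eq_zero_or_pos c with rfl | hc
  · rw [Nat.zero_add, Nat.div_eq_of_lt (by omega)]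
  · obtain ⟨K', rfl⟩ : ∃ K', K = K' + 1 := ⟨K - 1, by omega⟩
    obtain ⟨c', rfl⟩ : ∃ c', c = c' + 1 := ⟨c - 1, by omega⟩
    apply Nat.div_le_of_le_mul
    have h0 : 0 ≤ K' * c' := Nat.zero_le _
    have h1 : c' + 1 + (K' + 1) - 1 = K' + c' + 1 := by omega
    rw [h1]
    nlinarith

/-- `⌈c / K⌉ ≤ ⌊c / K⌋ + 1`. [folklore] -/
theorem cdiv_le_div_succ {K : ℕ} (hK : 1 ≤ K) (c : ℕ) : (c + K - 1) / K ≤ c / K + 1 := by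
  have h : c + K - 1 ≤ c + K * 1 := by omega
  calc (c + K - 1) / K ≤ (c + K * 1) / K := Nat.div_le_div_right h
    _ = c / K + 1 := by rw [Nat.add_mul_div_left _ _ (by omega)]

/-- Monotonicity of the raw wire count in the node count, the level count and the output fan-in.
[folklore] -/
theorem edge_mono {I I₀ N Λ d L e F : ℕ} (hI : I ≤ I₀) (hΛ : Λ ≤ d) (hL : L ≤ d + 1) :
    (I + I * I) * (N + 1) + Λ * ((I + I * I) * (I * I) ^ e * F + (I + I * I) * ((I * I) ^ e + 1)) + L ≤
      (I₀ + I₀ * I₀) * (N + 1) +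
        d * ((I₀ + I₀ * I₀) * (I₀ * I₀) ^ e * F + (I₀ + I₀ * I₀) * ((I₀ * I₀) ^ e + 1)) + (d + 1) := by
  have hA : I + I * I ≤ I₀ + I₀ * I₀ := add_le_add hI (Nat.mul_le_mul hI hI)
  have hP : (I * I) ^ e ≤ (I₀ * I₀) ^ e := Nat.pow_le_pow_left (Nat.mul_le_mul hI hI) e
  gcongr

section SLPValue

variable [Fintype σ] [DecidableEq σ] (P : SLP k σ)

/-- **`K`-fold VSBR for a value of a straight-line program**: a value of total degree `≤ d` of a
straight-line program of length `s` over `N` variables is computed, for every `K ≥ 1`, by an unbounded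
fan-in circuit of product-depth `≤ ⌈⌈log₂ d⌉ / K⌉` with at most `iterEdgeBound K N d s` wires.
[cite: ValiantSkyumBerkowitzRackoff1983] [cite: Burgisser2000TCS, Thm. 2.5] [cite: Tavenas2015, Prop. 3] -/
theorem slp_exists_circuit_productDepth_le_clog_div {K : ℕ} (hK : 1 ≤ K) {i : ℕ} (hi : i < P.len) {d : ℕ}
    (hd : (P.val i).totalDegree ≤ d) :
    ∃ C : ArithCircuit k σ, C.eval = P.val i ∧ C.productDepth ≤ (Nat.clog 2 d + K - 1) / K ∧
      C.edgeSize ≤ iterEdgeBound K (Fintype.card σ) d P.len := by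
  set H := P.homogenize d with hH
  -- the `K`-fold scheme `(expandIter K, (#ι²)^(iterExp K), 5^K, 2^K)` of parts 1–2
  set S : Scheme H :=
    { E := expandIter H K, W := termWidth (P.Node d) ^ iterExp K, F := 5 ^ K, B := 2 ^ K,
      B_pos := Nat.two_pow_pos K, length_le := length_expandIter_le H K,
      tlength_le := expandIter_length_le H K, sum_eq := fun a _ => expandIter_sum H K a,
      deg_le := expandIter_deg H K } with hS
  set Λ := (Nat.clog 2 d + K - 1) / K with hΛ
  set ns : List (Atom (P.Node d)) :=
    (List.finRange (d + 1)).map fun e => .node (⟨i, hi⟩, SLP.Tag.Q e) with hns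
  -- `⌈log₂ d⌉ ≤ K · ⌈⌈log₂ d⌉ / K⌉` (ceiling division; inlined, the named form is `le_mul_ceilDiv` elsewhere)
  have hKΛ : Nat.clog 2 d ≤ K * Λ := by
    have h1 : K * Λ + (Nat.clog 2 d + K - 1) % K = Nat.clog 2 d + K - 1 := Nat.div_add_mod _ K
    have h2 := Nat.mod_lt (Nat.clog 2 d + K - 1) (show 0 < K by omega)
    omega
  have hdeg : ∀ a ∈ ns, H.adeg a ≤ S.B ^ Λ := by
    intro a ha
    simp only [hns, List.mem_map] at ha
    obtain ⟨e, -, rfl⟩ := ha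
    have he := e.isLt
    calc H.adeg (.node (⟨i, hi⟩, SLP.Tag.Q e)) = e.val := rfl
      _ ≤ d := by omega
      _ ≤ 2 ^ Nat.clog 2 d := Nat.le_pow_clog one_lt_two d
      _ ≤ 2 ^ (K * Λ) := Nat.pow_le_pow_right (by norm_num) hKΛ
      _ = S.B ^ Λ := pow_mul 2 K Λ
  refine ⟨S.circuit Λ ns, ?_, S.productDepth_circuit_le Λ ns, ?_⟩
  · rw [S.eval_circuit Λ ns hdeg, hns, List.map_map]
    have hval : ∀ e : Fin (d + 1), (H.aval ∘ fun e : Fin (d + 1) =>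
        HomCircuit.Atom.node ((⟨i, hi⟩ : Fin P.len), SLP.Tag.Q e)) e =
        homogeneousComponent e.val (P.val i) := fun e => rfl
    rw [List.map_congr_left (fun e _ => hval e), ← Fin.sum_univ_def,
      Fin.sum_univ_eq_sum_range (fun e => homogeneousComponent e (P.val i)) (d + 1),
      sum_homogeneousComponent_of_le hd]
  · refine (S.edgeSize_circuit_le Λ ns).trans ?_
    have hW : S.W = (Fintype.card (P.Node d) * Fintype.card (P.Node d)) ^ iterExp K := rfl
    have hF : S.F = 5 ^ K := rfl
    rw [HomCircuit.card_atom, hW, hF]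
    unfold iterEdgeBound
    refine edge_mono (P.card_node_le d) ?_ (by simp [hns])
    exact (cdiv_le hK _).trans ((Nat.clog_le_iff_le_pow one_lt_two).2 Nat.lt_two_pow_self.le)

end SLPValue

omit [CommSemiring k] in
/-- A gate-free circuit has no wires. [folklore] -/
theorem edgeSize_eq_zero_of_gates_eq_nil (Q : ArithCircuit k σ) (h : Q.gates = []) :
    Q.edgeSize = 0 := by
  simp [ArithCircuit.edgeSize, h]

/-- `iterEdgeBound` is monotone in the size parameter. [folklore] -/
theorem iterEdgeBound_mono_s {K N d s s' : ℕ} (h : s ≤ s') :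
    iterEdgeBound K N d s ≤ iterEdgeBound K N d s' := by
  unfold iterEdgeBound
  gcongr

/-- **Valiant–Skyum–Berkowitz–Rackoff with `K` halvings per level.** A polynomial of total degree `≤ d`
over a finite set of `N` variables is computed, for every `K ≥ 1`, by an unbounded fan-in arithmetic circuit
of product-depth `≤ ⌈⌈log₂ d⌉ / K⌉` with at most `iterEdgeBound K N d L(f)` wires (`L(f)` its fan-in-two
complexity) — polynomially many for fixed `K`.
[cite: ValiantSkyumBerkowitzRackoff1983] [cite: Burgisser2000TCS, Thm. 2.5] [cite: Tavenas2015, Prop. 3] -/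
theorem exists_computes_productDepth_le_clog_div [Fintype σ] [DecidableEq σ] {K : ℕ} (hK : 1 ≤ K)
    (f : MvPolynomial σ k) {d : ℕ} (hd : f.totalDegree ≤ d) :
    ∃ C : ArithCircuit k σ, C.Computes f ∧ C.productDepth ≤ (Nat.clog 2 d + K - 1) / K ∧
      C.edgeSize ≤ iterEdgeBound K (Fintype.card σ) d (complexity f) := by
  obtain ⟨Q, hfan, hcomp, hsize⟩ := ArithCircuit.exists_computes_size_eq_complexity f
  obtain ⟨P, hlen, hcases⟩ := exists_slp Q hfan
  rw [show Q.eval = f from hcomp] at hcases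
  rcases hcases with ⟨i, hi, hfi⟩ | ⟨j, hfj⟩ | ⟨c, hfc⟩
  · have hdi : (P.val i).totalDegree ≤ d := by rw [← hfi]; exact hd
    obtain ⟨C, hCe, hCd, hCs⟩ := slp_exists_circuit_productDepth_le_clog_div P hK hi hdi
    refine ⟨C, hCe.trans hfi.symm, hCd, ?_⟩
    rwa [hlen, hsize] at hCs
  · exact ⟨ArithCircuit.ofVar j, by rw [ArithCircuit.Computes, ArithCircuit.eval_ofVar, hfj],
      by rw [productDepth_ofVar]; exact Nat.zero_le _,
      by rw [edgeSize_eq_zero_of_gates_eq_nil _ rfl]; exact Nat.zero_le _⟩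
  · exact ⟨ArithCircuit.ofConst c, by rw [ArithCircuit.Computes, ArithCircuit.eval_ofConst, hfc],
      by rw [productDepth_ofConst]; exact Nat.zero_le _,
      by rw [edgeSize_eq_zero_of_gates_eq_nil _ rfl]; exact Nat.zero_le _⟩

end Reduction

end TopBracket

end Summit.ValiantsHypothesis.ValiantsHypothesis.Theorems.DepthWindow

end
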